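import Summits.ValiantsHypothesis.ValiantsHypothesis.Theorems.BarrierLeverPartitionMinorsMooreBenchLead
import Summits.ValiantsHypothesis.ValiantsHypothesis.Theorems.BarrierLeverPartitionMinorsMooreBenchReduction

/-!
# Route BarrierLever — item 20172 (CPM), benchmark row 14: THE HIERARCHICAL MOORE PEEL —
# Theorem A of planner p1 g18's memo: `(∀ i ≤ h, det G_i ≠ 0) → MCBenchPairsAt h`

Helper file (`--supports stmt-ValiantsHypothesis-20172`; cell valiant-natproofs, rung V4, 𝒟-side of
door (c), benchmark «row 14» of the director's round-3 table, duty (iv); seat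
valiant-natproofs-prover gen 14).  Closes NO item; definition-free.  Source: `HOME/p1/g18/MEMO-g18.md`
§2 (planner valiant-natproofs-p1 g18), typed in LINEAR-INDEPENDENCE form: instead of the lowest-order
coefficient of a determinant we follow the linear independence of the row family through the peel.

* `peel_step` — ONE STAGE (memo §2.3): if the rows alive at stage `(i+1, n)` are linearly
  independent over `A = MvPolynomial (Fin h) ℂ` and `det G_i ≠ 0`, then so are the rows alive at
  stage `(i, n+1)` (`i + n = h`).  Mechanism: substitute the peeled node `Y_n ↦ X` (an injective
  ring map `A → A[X]`, `linearIndependent_of_map_ringHom`), then stage reduction I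
  (`…MooreBenchStage.linearIndependent_rowVec_of_reduced`: scaling by `X^j`, reduction against the
  fixed rows) and stage reduction II (`…MooreBenchLead.linearIndependent_reducedRow`: recombination
  by `G_i⁻¹`, leading coefficients = the rows alive at stage `(i+1, n)`).
* `linearIndependent_stageRows` — the induction from the terminal stage (all `c_{h+1}` monomial rows,
  unit vectors) down to stage `1`.
* **`mcBenchPairsAt_of_peel`** — THEOREM A: `(∀ i ∈ [1, h], det (peelMatrix i) ≠ 0) → MCBenchPairsAt h`
  (with `…MooreBenchReduction.mcBenchPairsAt_of_linearIndependent`).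

WHAT THIS IS NOT: a proof of MC-bench(2) for all `h` (the hypothesis fails first at `i = 183`, memo
§3); nothing on items 20172 / 20195 / 19717 themselves, on crux stmt-ValiantsHypothesis-14610, or on
`VP` versus `VNP`.
-/

set_option linter.dupNamespace false

namespace Summit.ValiantsHypothesis.ValiantsHypothesis.Theorems.BarrierLever.MoorePeel

open Polynomial Finset

/-! ## 1. The peel step -/

/-- **THE PEEL STEP** (memo §2.3).  Let `i + n = h`, `1 ≤ i`.  If the rows alive at stage
`(i+1, n)` are linearly independent over `MvPolynomial (Fin h) ℂ` and `det G_i ≠ 0`, then the rows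
alive at stage `(i, n+1)` are linearly independent. -/
theorem peel_step (h i n : ℕ) (hin : i + n = h) (hi : 1 ≤ i) (hG : (peelMatrix i).det ≠ 0)
    (IH : LinearIndependent (MvPolynomial (Fin h) ℂ)
      (fun y : ↥(stageRows (i + 1) n) => rowVec (windowStart (h + 1)) (nodeY h) (y : RowLabel))) :
    LinearIndependent (MvPolynomial (Fin h) ℂ)
      (fun x : ↥(stageRows i (n + 1)) => rowVec (windowStart (h + 1)) (nodeY h) (x : RowLabel)) := by
  classical
  have hn : n < h := by omega
  -- the substitution `Y_n ↦ X`, an injective ring map `A → A[X]`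
  set σ : MvPolynomial (Fin h) ℂ →ₐ[ℂ] Polynomial (MvPolynomial (Fin h) ℂ) :=
    MvPolynomial.aeval fun v : Fin h =>
      if (v : ℕ) = n then (Polynomial.X : Polynomial (MvPolynomial (Fin h) ℂ))
      else Polynomial.C (MvPolynomial.X v) with hσ
  have hσX : ∀ v : Fin h, σ (MvPolynomial.X v) =
      if (v : ℕ) = n then Polynomial.X else Polynomial.C (MvPolynomial.X v) := fun v => by
    rw [hσ, MvPolynomial.aeval_X]
  have hσinj : Function.Injective σ := by
    set τ : Polynomial (MvPolynomial (Fin h) ℂ) →ₐ[MvPolynomial (Fin h) ℂ] MvPolynomial (Fin h) ℂ :=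
      Polynomial.aeval (MvPolynomial.X ⟨n, hn⟩) with hτ
    have hcomp : (τ.restrictScalars ℂ).comp σ = AlgHom.id ℂ _ := by
      refine MvPolynomial.algHom_ext fun v => ?_
      rw [AlgHom.comp_apply, AlgHom.restrictScalars_apply, hσX, AlgHom.id_apply]
      split_ifs with hv
      · rw [hτ, Polynomial.aeval_X]
        congr 1
        exact Fin.ext hv.symm
      · rw [hτ, Polynomial.aeval_C]
        rfl
    intro p q e
    have := congrArg (τ.restrictScalars ℂ) e
    rwa [← AlgHom.comp_apply, ← AlgHom.comp_apply, hcomp, AlgHom.id_apply, AlgHom.id_apply] at this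
  -- the node table after substitution
  obtain ⟨Z, hZn, hZne, hσY⟩ : ∃ Z : ℕ → Polynomial (MvPolynomial (Fin h) ℂ),
      Z n = Polynomial.X ∧ (∀ b, b ≠ n → Z b = Polynomial.C (nodeY h b)) ∧
      ∀ b, σ (nodeY h b) = Z b := by
    refine ⟨fun b => if b = n then Polynomial.X else Polynomial.C (nodeY h b), by simp,
      fun b hb => by simp [hb], fun b => ?_⟩
    by_cases hb : b < h
    · rw [nodeY, dif_pos hb, hσX]
      simp only [nodeY, dif_pos hb]
    · have hbn : b ≠ n := fun e => hb (e ▸ hn)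
      simp only [nodeY, dif_neg hb, map_zero, if_neg hbn]
  have hZlt : ∀ b, b < n → Z b = Polynomial.C (nodeY h b) := fun b hb => hZne b (ne_of_lt hb)
  -- transfer along `σ`: it suffices to treat the rows over `A[X]` with node table `Z`
  apply linearIndependent_of_map_ringHom σ.toRingHom hσinj
  have hV0 : (fun (x : ↥(stageRows i (n + 1))) (c : Fin (windowStart (h + 1))) =>
      σ.toRingHom (rowVec (windowStart (h + 1)) (nodeY h) (x : RowLabel) c)) =
      fun (x : ↥(stageRows i (n + 1))) c => rowVec (windowStart (h + 1)) Z (x : RowLabel) c := by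
    funext x c
    rw [map_rowVec]
    exact congrFun (congrArg (rowVec (windowStart (h + 1)) · (x : RowLabel)) (funext hσY)) c
  rw [hV0]
  -- stage reduction I (`…MooreBenchStage`) and II (`…MooreBenchLead`)
  exact linearIndependent_rowVec_of_reduced (windowStart (h + 1)) i n (nodeY h) Z hZn hZlt
    (linearIndependent_reducedRow h i n (windowStart (h + 1)) hG IH)

/-! ## 2. The induction over the stages and Theorem A -/

/-- The terminal stage `(h+1, 0)`: all `c_{h+1}` monomial rows, i.e. the unit vectors. -/
theorem linearIndependent_stageRows_terminal (h : ℕ) :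
    LinearIndependent (MvPolynomial (Fin h) ℂ)
      (fun x : ↥(stageRows (h + 1) 0) => rowVec (windowStart (h + 1)) (nodeY h) (x : RowLabel)) := by
  classical
  have hval : ∀ x : ↥(stageRows (h + 1) 0), ∃ m : Fin (windowStart (h + 1)),
      (x : RowLabel) = Sum.inl (m : ℕ) := by
    rintro ⟨x, hx⟩
    rcases x with m | ⟨j, b⟩ | ⟨b, b'⟩
    · exact ⟨⟨m, inl_mem_stageRows.mp hx⟩, rfl⟩
    · exact absurd (inr_inl_mem_stageRows.mp hx).2 (Nat.not_lt_zero _)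
    · exact absurd (inr_inr_mem_stageRows.mp hx).2 (Nat.not_lt_zero _)
  choose e he using hval
  have heinj : Function.Injective e := fun x y exy => Subtype.ext (by rw [he x, he y, exy])
  have hfam : (fun x : ↥(stageRows (h + 1) 0) =>
      rowVec (windowStart (h + 1)) (nodeY h) (x : RowLabel)) =
      fun x col => if col = e x then (1 : MvPolynomial (Fin h) ℂ) else 0 := by
    funext x col
    rw [he x]
    simp only [rowVec]
    by_cases hc : col = e x
    · rw [if_pos hc, if_pos (congrArg Fin.val hc)]
    · rw [if_neg hc, if_neg (fun e' => hc (Fin.ext e'))]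
  rw [hfam]
  exact linearIndependent_unitVec e heinj

/-- **All stages.**  For `i + n = h + 1`, `1 ≤ i`: if `det G_{i'} ≠ 0` for all `i ≤ i' ≤ h`, then the
rows alive at stage `(i, n)` are linearly independent over `MvPolynomial (Fin h) ℂ`. -/
theorem linearIndependent_stageRows (h : ℕ) :
    ∀ n i : ℕ, i + n = h + 1 → 1 ≤ i → (∀ i', i ≤ i' → i' ≤ h → (peelMatrix i').det ≠ 0) →
      LinearIndependent (MvPolynomial (Fin h) ℂ)
        (fun x : ↥(stageRows i n) => rowVec (windowStart (h + 1)) (nodeY h) (x : RowLabel)) := by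
  intro n
  induction n with
  | zero =>
    intro i hin _ _
    rw [add_zero] at hin
    subst hin
    exact linearIndependent_stageRows_terminal h
  | succ n ih =>
    intro i hin hi hdet
    exact peel_step h i n (by omega) hi (hdet i le_rfl (by omega))
      (ih (i + 1) (by omega) (by omega) fun i' hi' hi'h => hdet i' (by omega) hi'h)

/-- **THEOREM A** (planner valiant-natproofs-p1 g18, `HOME/p1/g18/MEMO-g18.md` §2: the hierarchical
Moore peel).  If the stage matrices `G_1, …, G_h` (`peelMatrix`) all have nonzero determinant,
then MC-bench(s = 2) holds at height `h`: for every injective enumeration of the subsets of `Fin h`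
of size `≤ 2` some complex node table `Y` makes the Moore–Chow benchmark minor
`[coeff_{E (u i) (benchCols j)} ∏_a (x_a + 1 + Σ_c Y_a^(2^c) y_c)]` nonsingular.  (Memo §3:
`det G_i ≠ 0` for every `i ≤ 182`, first zero at `i = 183`; the signature preview's hypothesis
`1 ≤ h` is not needed.) -/
theorem mcBenchPairsAt_of_peel (h : ℕ)
    (hdet : ∀ i : ℕ, 1 ≤ i → i ≤ h → (peelMatrix i).det ≠ 0) : MCBenchPairsAt h :=
  mcBenchPairsAt_of_linearIndependent h
    (linearIndependent_stageRows h h 1 (by omega) le_rfl fun i' hi' hi'h => hdet i' hi' hi'h)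

end Summit.ValiantsHypothesis.ValiantsHypothesis.Theorems.BarrierLever.MoorePeel
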